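import Mathlib
import HarnessLib

/-!
# Crux `PoloidalLiouville` (stmt-NavierStokesRegularity-1222), crux idea «horizon-threading-tower» (ns-idea-15):
# ONE-VARIABLE ROOT ARITHMETIC FOR THE NULL-CONE CHART (Wronskians and common powers in `ℂ[t]`)

Support file (`--supports stmt-NavierStokesRegularity-1222`, helper; cell `ns-wall-extremal`, width hand ns-wall-eng-3 g4; 0 kit).

Pure `Polynomial ℂ` lemmas consumed by the finite-tower theorems of the line (`…FiniteTowerTopShell`, `…FiniteTowerDescent`) after
the loop bracket of two shells has been turned into a weighted Wronskian on the isotropic chart (`Zonal.chartT_detP`):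

* `exists_C_mul_of_wronskian_eq_zero` — `W(F, G) = 0`, `G ≠ 0` ⇒ `F = c·G` (gcd reduction + Mathlib's `IsCoprime.wronskian_eq_zero_iff`);
* `wronskian_pow_pow_eq_zero` — the weighted Wronskian law `a·f·g′ = b·g·f′` (`a, b ≥ 1`) gives `W(f^b, g^a) = 0`;
* `eq_C_mul_pow_of_pow_eq` / `exists_eq_C_mul_pow_of_pow_eq` — `f^D = c·(q^d)^D`, `D ≥ 1` ⇒ `f = γ·q^d` (roots multisets);
* ★ `exists_monic_eq_C_mul_pow_of_coprime` — `f^a = c·g^b` with `f ≠ 0` and `gcd(a,b) = 1` ⇒ `g = lc(g)·q^a` with `q` monic,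
  `a·deg q = deg g` (every root multiplicity of `g` is divisible by `a`; Bezout in `ℕ`).

HONEST LABEL: elementary algebra; no sketch Prop closed; `HorizonTowerZonality` (general towers), `PoloidalLiouville` (1222) OPEN;
NS regularity NOT proved.  [folklore]
-/

-- the summit and its single sub-problem share the name (CONVENTIONS §1)
set_option linter.dupNamespace false

noncomputable section

open Polynomial

namespace Summit.NavierStokesRegularity.NavierStokesRegularity.Theorems.PoloidalLiouville.HorizonTower.Zonal

/-! ### Wronskians -/

/-- Wronskian of a common multiple: `W(d·F, d·G) = d² · W(F, G)`. [folklore] -/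
theorem wronskian_mul_mul (d F G : ℂ[X]) : wronskian (d * F) (d * G) = d ^ 2 * wronskian F G := by
  simp only [wronskian, derivative_mul]
  ring

/-- **Vanishing Wronskian ⇒ proportional** (over `ℂ`): `W(F, G) = 0`, `G ≠ 0` ⇒ `F = c · G`. [folklore] -/
theorem exists_C_mul_of_wronskian_eq_zero {F G : ℂ[X]} (hG : G ≠ 0) (hW : wronskian F G = 0) :
    ∃ c : ℂ, F = C c * G := by
  set d : ℂ[X] := GCDMonoid.gcd F G with hd
  have hd0 : d ≠ 0 := gcd_ne_zero_of_right hG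
  have hF : F = d * (F / d) := (EuclideanDomain.mul_div_cancel' hd0 (GCDMonoid.gcd_dvd_left F G)).symm
  have hG' : G = d * (G / d) := (EuclideanDomain.mul_div_cancel' hd0 (GCDMonoid.gcd_dvd_right F G)).symm
  have hcop : IsCoprime (F / d) (G / d) := isCoprime_div_gcd_div_gcd hG
  have hW' : wronskian (F / d) (G / d) = 0 := by
    have h := hW
    rw [hF, hG', wronskian_mul_mul] at h
    exact (mul_eq_zero.mp h).resolve_left (pow_ne_zero 2 hd0)
  obtain ⟨hF1, hG1⟩ := hcop.wronskian_eq_zero_iff.mp hW'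
  set c₁ : ℂ := (F / d).coeff 0 with hc₁
  set c₂ : ℂ := (G / d).coeff 0 with hc₂
  have hF2 : F / d = C c₁ := eq_C_of_natDegree_eq_zero (derivative_eq_zero.mp hF1)
  have hG2 : G / d = C c₂ := eq_C_of_natDegree_eq_zero (derivative_eq_zero.mp hG1)
  have eF : F = d * C c₁ := by rw [← hF2]; exact hF
  have eG : G = d * C c₂ := by rw [← hG2]; exact hG'
  have hc2 : c₂ ≠ 0 := by
    intro h0
    apply hG
    rw [eG, h0, C_0, mul_zero]
  refine ⟨c₁ / c₂, ?_⟩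
  rw [eF, eG, show C (c₁ / c₂) * (d * C c₂) = d * (C (c₁ / c₂) * C c₂) by ring, ← C_mul, div_mul_cancel₀ c₁ hc2]

/-- **The weighted Wronskian law gives an honest Wronskian**: `a·f·g′ = b·g·f′` with `a, b ≥ 1` ⇒ `W(f^b, g^a) = 0`. [folklore] -/
theorem wronskian_pow_pow_eq_zero {f g : ℂ[X]} {a b : ℕ} (ha : 1 ≤ a) (hb : 1 ≤ b)
    (h : (a : ℂ[X]) * f * derivative g = (b : ℂ[X]) * g * derivative f) : wronskian (f ^ b) (g ^ a) = 0 := by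
  obtain ⟨a', rfl⟩ := Nat.exists_eq_add_of_le' ha
  obtain ⟨b', rfl⟩ := Nat.exists_eq_add_of_le' hb
  rw [wronskian, derivative_pow_succ, derivative_pow_succ]
  push_cast at h
  rw [show (C ((a' : ℂ) + 1) : ℂ[X]) = (a' : ℂ[X]) + 1 by rw [C_add, C_1, map_natCast],
    show (C ((b' : ℂ) + 1) : ℂ[X]) = (b' : ℂ[X]) + 1 by rw [C_add, C_1, map_natCast]]
  linear_combination (f ^ b' * g ^ a') * h

/-! ### Common powers from roots -/

/-- A nonzero scalar does not change the roots. [folklore] -/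
theorem roots_C_mul_pow_eq {c : ℂ} (hc : c ≠ 0) (q : ℂ[X]) (n : ℕ) : (C c * q ^ n).roots = n • q.roots := by
  rw [roots_C_mul _ hc, roots_pow]

/-- **Root extraction**: `f^D = c · (q^d)^D` with `q` monic and `D ≥ 1` ⇒ `f = lc(f) · q^d`. [folklore] -/
theorem eq_C_mul_pow_of_pow_eq {f q : ℂ[X]} {D d : ℕ} (hD : 1 ≤ D) (hq : q.Monic) {c : ℂ}
    (h : f ^ D = C c * (q ^ d) ^ D) : f = C f.leadingCoeff * q ^ d := by
  by_cases hf : f = 0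
  · rw [hf, leadingCoeff_zero, C_0, zero_mul]
  have hD0 : D ≠ 0 := by omega
  have hc : c ≠ 0 := by
    rintro rfl
    rw [C_0, zero_mul] at h
    exact hf ((pow_eq_zero_iff hD0).mp h)
  -- roots: `D • roots f = D • (d • roots q)`
  have hroots : f.roots = d • q.roots := by
    have h1 := congrArg Polynomial.roots h
    rw [roots_pow, roots_C_mul_pow_eq hc, roots_pow] at h1
    exact (nsmul_right_injective hD0) h1
  -- `f` splits over `ℂ`
  have hsplit := (IsAlgClosed.splits f).eq_prod_roots
  rw [hroots, Multiset.map_nsmul, Multiset.prod_nsmul, ← (IsAlgClosed.splits q).eq_prod_roots_of_monic hq] at hsplit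
  exact hsplit

/-- **Root extraction, non-monic base**: `f^D = c · (q^d)^D` with `q ≠ 0` and `D ≥ 1` ⇒ `f = γ · q^d` for some scalar `γ`.
[folklore] -/
theorem exists_eq_C_mul_pow_of_pow_eq {f q : ℂ[X]} {D d : ℕ} (hD : 1 ≤ D) (hq : q ≠ 0) {c : ℂ}
    (h : f ^ D = C c * (q ^ d) ^ D) : ∃ γ : ℂ, f = C γ * q ^ d := by
  by_cases hf : f = 0
  · exact ⟨0, by rw [hf, C_0, zero_mul]⟩
  have hD0 : D ≠ 0 := by omega
  have hc : c ≠ 0 := by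
    rintro rfl
    rw [C_0, zero_mul] at h
    exact hf ((pow_eq_zero_iff hD0).mp h)
  have hroots : f.roots = d • q.roots := by
    have h1 := congrArg Polynomial.roots h
    rw [roots_pow, roots_C_mul_pow_eq hc, roots_pow] at h1
    exact (nsmul_right_injective hD0) h1
  have hlq : q.leadingCoeff ≠ 0 := leadingCoeff_ne_zero.mpr hq
  -- `(roots q).prod (X − ·) = lc(q)⁻¹ · q`
  have hq' : (q.roots.map (X - C ·)).prod = C q.leadingCoeff⁻¹ * q := by
    have hs := (IsAlgClosed.splits q).eq_prod_roots
    calc (q.roots.map (X - C ·)).prod = C q.leadingCoeff⁻¹ * (C q.leadingCoeff * (q.roots.map (X - C ·)).prod) := by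
          rw [← mul_assoc, ← C_mul, inv_mul_cancel₀ hlq, C_1, one_mul]
      _ = C q.leadingCoeff⁻¹ * q := by rw [← hs]
  refine ⟨f.leadingCoeff * q.leadingCoeff⁻¹ ^ d, ?_⟩
  have hsplit := (IsAlgClosed.splits f).eq_prod_roots
  rw [hroots, Multiset.map_nsmul, Multiset.prod_nsmul, hq', mul_pow, ← C_pow, ← mul_assoc, ← C_mul] at hsplit
  exact hsplit

/-- Root multiplicities under a pure-power relation: `f^a = c·g^b` (`c ≠ 0`) ⇒ `a·mult_ζ(f) = b·mult_ζ(g)`. [folklore] -/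
theorem count_roots_of_pow_eq {f g : ℂ[X]} {a b : ℕ} {c : ℂ} (hc : c ≠ 0) (h : f ^ a = C c * g ^ b) (ζ : ℂ) :
    a * f.roots.count ζ = b * g.roots.count ζ := by
  have h1 := congrArg Polynomial.roots h
  rw [roots_pow, roots_C_mul_pow_eq hc] at h1
  have h2 := congrArg (Multiset.count ζ) h1
  rwa [Multiset.count_nsmul, Multiset.count_nsmul] at h2

/-- ★ **COPRIME EXPONENTS FORCE A COMMON POWER**: `f^a = c · g^b` with `f ≠ 0`, `a ≥ 1` and `gcd(a, b) = 1` ⇒ `g = lc(g) · q^a` for a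
MONIC `q` with `a · deg q = deg g` (every root of `g` has multiplicity divisible by `a`). [folklore] -/
theorem exists_monic_eq_C_mul_pow_of_coprime {f g : ℂ[X]} {a b : ℕ} (hab : a.Coprime b) (ha : 1 ≤ a) (hf : f ≠ 0)
    {c : ℂ} (h : f ^ a = C c * g ^ b) :
    ∃ q : ℂ[X], q.Monic ∧ g = C g.leadingCoeff * q ^ a ∧ a * q.natDegree = g.natDegree := by
  classical
  have ha0 : a ≠ 0 := by omega
  have hc : c ≠ 0 := by
    rintro rfl
    rw [C_0, zero_mul] at h
    exact hf ((pow_eq_zero_iff ha0).mp h)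
  have hcount := count_roots_of_pow_eq hc h
  -- a multiset `M` with `a • M = roots g`
  obtain ⟨M, hM⟩ : ∃ M : Multiset ℂ, a • M = g.roots := by
    rcases Nat.lt_or_ge 1 a with ha1 | ha1
    · -- Bezout: `b·m = a·t + 1`
      obtain ⟨m, -, hm⟩ := Nat.exists_mul_mod_eq_one_of_coprime hab.symm ha1
      set t : ℕ := b * m / a with ht
      have hbez : b * m = a * t + 1 := by
        have hdm := Nat.div_add_mod (b * m) a
        rw [hm] at hdm
        rw [ht]; omega
      refine ⟨m • f.roots - t • g.roots, ?_⟩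
      ext ζ
      rw [Multiset.count_nsmul, Multiset.count_sub, Multiset.count_nsmul, Multiset.count_nsmul]
      have hζ := hcount ζ
      generalize f.roots.count ζ = fc at hζ ⊢
      generalize g.roots.count ζ = gc at hζ ⊢
      have key : gc + a * (t * gc) = a * (m * fc) := by
        zify at hζ hbez ⊢
        linear_combination (-(m : ℤ)) * hζ - (gc : ℤ) * hbez
      have hle : t * gc ≤ m * fc := Nat.le_of_mul_le_mul_left (by omega) (by omega : 0 < a)
      rw [Nat.mul_sub]
      omega
    · have ha' : a = 1 := le_antisymm ha1 ha
      exact ⟨g.roots, by rw [ha', one_smul]⟩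
  refine ⟨(M.map (X - C ·)).prod, monic_multisetProd_X_sub_C M, ?_, ?_⟩
  · have hsplit := (IsAlgClosed.splits g).eq_prod_roots
    rw [← hM, Multiset.map_nsmul, Multiset.prod_nsmul] at hsplit
    exact hsplit
  · rw [natDegree_multiset_prod_X_sub_C_eq_card, ← Multiset.card_nsmul, hM]
    exact (IsAlgClosed.splits g).natDegree_eq_card_roots.symm

end Summit.NavierStokesRegularity.NavierStokesRegularity.Theorems.PoloidalLiouville.HorizonTower.Zonal

end
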